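import Literature.AlgebraicGeometry.Deformation.MorphismLiftsSquareZeroAffine
import HarnessLib

/-!
# Functoriality of the affine lift-torsor across a square-zero thickening (SGA 1 III Prop. 5.1, naturality)

Layer `Literature/AlgebraicGeometry/Deformation`, namespace `Literature.AlgebraicGeometry.Deformation`.
THEOREMS ONLY (no definition, no named fact, no instance).  Sequel of ★ `MorphismLiftsSquareZeroAffine`
([SGA1, Exp. III §5 Prop. 5.1] read on an affine open: two `S`-lifts `g₁ g₂ : Spec B → X` through an affine open `V`,
agreeing on the square-zero closed subscheme `Spec B₀`, differ by a unique derivation `δ : Γ(X, V) → ker π`,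
`ψ_{g₂} = ψ_{g₁} + δ` on the charts `ψ_g = g.appLE V ⊤ ≫ ΓSpecIso B`).  [SGA1, Exp. III §5 Prop. 5.1] asserts the
torsor structure «de façon naturelle»; the proof there («la vérification … est une simple question de patience»)
leaves the naturalities to the reader.  This file records the three the gluing of local lifts and the
unit-section argument of [MumfordFogartyKirwan1994, Prop. 6.15] consume, all as identities of charts (def-free):

* §1 CHANGE OF SOURCE along a morphism of affine square-zero thickenings `u : B → C` over `R₀` with
  `π_C ∘ u = u₀ ∘ π_B`: the pulled-back pair `(Spec u ≫ g₁, Spec u ≫ g₂)` is again a pair of `S`-lifts through `V`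
  agreeing on `Spec C₀` (`specMap_comp_over`, `specMap_comp_agree`, `preimage_specMap_comp_eq_top`), its charts are
  `u ∘ ψ_{gᵢ}` (`chart_specMap_comp`), hence **its derivation is `u ∘ δ`** (`charts_specMap_comp_of_derivation`,
  `derivation_specMap_comp_eq`) — the case `u = B → B_f` is the RESTRICTION of the torsor to a basic open (v-loc);
* §2 CHANGE OF TARGET along an `S`-morphism `h : X → X′` carrying `V` into an affine open `V′`: the pushed pair
  `(g₁ ≫ h, g₂ ≫ h)` is a pair of `S`-lifts through `V′` agreeing on `Spec B₀` (`comp_over`, `comp_agree`,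
  `preimage_comp_eq_top`), its charts are `ψ_{gᵢ} ∘ h^*` with `h^* = h.appLE V′ V` (`chart_comp`), hence **its
  derivation is `δ ∘ h^*`** (`charts_comp_of_derivation`, `derivation_comp_eq`) — [SGA1, Exp. III §5 Prop. 5.1]'s
  functoriality in `X` (`dh` acting on `𝓗om(g₀^*Ω¹_{X/S}, 𝒥)`).

Cell hodgecm-mathlib (D-0151), SOCKETS-F §4 (α) node E3 brick DEF-MOR (v) (A-p01 (g8) census `E-census-E3E5` §1.3 row
E3.1 (v): «functoriality in the SOURCE … and in the TARGET»); count-neutral generic capital.  HC_CM is proved only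
modulo the 7 printed citations until rung 0 closes; this file discharges none of them.

## References
* [SGA1] A. Grothendieck, M. Raynaud, *Revêtements étales et groupe fondamental (SGA 1)*, LNM 224 / arXiv:math/0206203:
  Exp. III §5 Prop. 5.1 (arXiv ed. p. 71, held `paper:arxiv-math_0206203` p0049–p0050: «de façon naturelle», «fonctoriel»).
* [MumfordFogartyKirwan1994] D. Mumford, J. Fogarty, F. Kirwan, *Geometric Invariant Theory*, 3rd ed. (1994), Ch. 6 §3
  Prop. 6.15 (p. 130–131): «by a simple functorial property of the obstruction» — the consumer of record.
-/

universe u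

open CategoryTheory CategoryTheory.Limits AlgebraicGeometry

noncomputable section

namespace Literature.AlgebraicGeometry.Deformation

/-! ### §1 Change of source: a morphism `u : B → C` of affine square-zero thickenings over `R₀` -/

section Source

variable {X : Scheme.{u}} {V : X.Opens} {R₀ B B₀ C C₀ : Type u} [CommRing R₀] [CommRing B] [CommRing B₀]
  [CommRing C] [CommRing C₀] [Algebra R₀ B] [Algebra R₀ C] (p : X ⟶ Spec (.of R₀))
  (πB : B →+* B₀) (πC : C →+* C₀) (u : B →ₐ[R₀] C)

/-- Pulling an `S`-morphism `g : Spec B → X` back along `Spec u : Spec C → Spec B` (`u` an `R₀`-algebra map) gives an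
`S`-morphism. [cite: SGA1, Exp. III §5 Prop. 5.1] -/
theorem specMap_comp_over (g : Spec (.of B) ⟶ X) (w : g ≫ p = Spec.map (CommRingCat.ofHom (algebraMap R₀ B))) :
    (Spec.map (CommRingCat.ofHom u.toRingHom) ≫ g) ≫ p = Spec.map (CommRingCat.ofHom (algebraMap R₀ C)) := by
  rw [Category.assoc, w, ← Spec.map_comp, ← CommRingCat.ofHom_comp]
  congr 2
  exact RingHom.ext fun r => u.commutes r

/-- If `u` is compatible with the thickenings (`π_C ∘ u = u₀ ∘ π_B`), two morphisms agreeing on `Spec B₀` pull back to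
morphisms agreeing on `Spec C₀`. [cite: SGA1, Exp. III §5 Prop. 5.1] -/
theorem specMap_comp_agree (u₀ : B₀ →+* C₀) (hu : πC.comp u.toRingHom = u₀.comp πB) {g₁ g₂ : Spec (.of B) ⟶ X}
    (h₀ : Spec.map (CommRingCat.ofHom πB) ≫ g₁ = Spec.map (CommRingCat.ofHom πB) ≫ g₂) :
    Spec.map (CommRingCat.ofHom πC) ≫ (Spec.map (CommRingCat.ofHom u.toRingHom) ≫ g₁) =
      Spec.map (CommRingCat.ofHom πC) ≫ (Spec.map (CommRingCat.ofHom u.toRingHom) ≫ g₂) := by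
  have key : Spec.map (CommRingCat.ofHom πC) ≫ Spec.map (CommRingCat.ofHom u.toRingHom) =
      Spec.map (CommRingCat.ofHom u₀) ≫ Spec.map (CommRingCat.ofHom πB) := by
    rw [← Spec.map_comp, ← Spec.map_comp, ← CommRingCat.ofHom_comp, ← CommRingCat.ofHom_comp, hu]
  rw [← Category.assoc, key, Category.assoc, h₀, ← Category.assoc, ← key, Category.assoc]

/-- The pulled-back morphism still lands in `V`. [cite: SGA1, Exp. III §5 Prop. 5.1] -/
theorem preimage_specMap_comp_eq_top {g : Spec (.of B) ⟶ X} (hg : g ⁻¹ᵁ V = ⊤) :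
    (Spec.map (CommRingCat.ofHom u.toRingHom) ≫ g) ⁻¹ᵁ V = ⊤ := by
  rw [Scheme.Hom.comp_preimage, hg]; rfl

/-- **The chart of the pulled-back morphism is `u ∘ ψ_g`**: `(Spec u ≫ g).appLE V ⊤ ≫ ΓSpecIso C = (g.appLE V ⊤ ≫ ΓSpecIso B) ≫ u`
(for `V` affine). [cite: SGA1, Exp. III §5 Prop. 5.1] -/
theorem chart_specMap_comp (hV : IsAffineOpen V) (g : Spec (.of B) ⟶ X) (hg : g ⁻¹ᵁ V = ⊤)
    (hg' : (Spec.map (CommRingCat.ofHom u.toRingHom) ≫ g) ⁻¹ᵁ V = ⊤) :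
    (Spec.map (CommRingCat.ofHom u.toRingHom) ≫ g).appLE V ⊤ hg'.ge ≫ (Scheme.ΓSpecIso (.of C)).hom =
      (g.appLE V ⊤ hg.ge ≫ (Scheme.ΓSpecIso (.of B)).hom) ≫ CommRingCat.ofHom u.toRingHom := by
  refine appLE_comp_ΓSpecIso_of_eq hV _ _ hg' ?_
  conv_lhs => rw [eq_specMap_appLE_comp_fromSpec hV g hg]
  simp only [Spec.map_comp, Category.assoc]

/-- **Change of source on the torsor: the derivation of the pulled-back pair is `u ∘ δ`** ([SGA1, Exp. III Prop. 5.1],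
naturality in the test scheme; with `u = B → B_f` this is the restriction of the torsor to a basic open).  Stated on the
charts: if `ψ_{g₂} = ψ_{g₁} + δ` then `ψ_{Spec u ≫ g₂} = ψ_{Spec u ≫ g₁} + u ∘ δ`. [cite: SGA1, Exp. III §5 Prop. 5.1] -/
theorem charts_specMap_comp_of_derivation (hV : IsAffineOpen V) {g₁ g₂ : Spec (.of B) ⟶ X} (hg₁ : g₁ ⁻¹ᵁ V = ⊤)
    (hg₂ : g₂ ⁻¹ᵁ V = ⊤) (hg₁' : (Spec.map (CommRingCat.ofHom u.toRingHom) ≫ g₁) ⁻¹ᵁ V = ⊤)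
    (hg₂' : (Spec.map (CommRingCat.ofHom u.toRingHom) ≫ g₂) ⁻¹ᵁ V = ⊤) {δ : Γ(X, V) → B}
    (hδ : ∀ a, (g₂.appLE V ⊤ hg₂.ge ≫ (Scheme.ΓSpecIso (.of B)).hom).hom a =
      (g₁.appLE V ⊤ hg₁.ge ≫ (Scheme.ΓSpecIso (.of B)).hom).hom a + δ a) (a : Γ(X, V)) :
    ((Spec.map (CommRingCat.ofHom u.toRingHom) ≫ g₂).appLE V ⊤ hg₂'.ge ≫ (Scheme.ΓSpecIso (.of C)).hom).hom a =
      ((Spec.map (CommRingCat.ofHom u.toRingHom) ≫ g₁).appLE V ⊤ hg₁'.ge ≫ (Scheme.ΓSpecIso (.of C)).hom).hom a +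
        u (δ a) := by
  rw [chart_specMap_comp u hV g₂ hg₂ hg₂', chart_specMap_comp u hV g₁ hg₁ hg₁']
  change u ((g₂.appLE V ⊤ hg₂.ge ≫ (Scheme.ΓSpecIso (.of B)).hom).hom a) =
    u ((g₁.appLE V ⊤ hg₁.ge ≫ (Scheme.ΓSpecIso (.of B)).hom).hom a) + u (δ a)
  rw [hδ a, map_add]

/-- The same read backwards (uniqueness side): ANY function `δ′` with `ψ_{Spec u ≫ g₂} = ψ_{Spec u ≫ g₁} + δ′` — in
particular the unique derivation of the pulled-back pair given by ★ `existsUnique_derivation_of_lifts` — equals `u ∘ δ`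
pointwise. [cite: SGA1, Exp. III §5 Prop. 5.1] -/
theorem derivation_specMap_comp_eq (hV : IsAffineOpen V) {g₁ g₂ : Spec (.of B) ⟶ X} (hg₁ : g₁ ⁻¹ᵁ V = ⊤)
    (hg₂ : g₂ ⁻¹ᵁ V = ⊤) (hg₁' : (Spec.map (CommRingCat.ofHom u.toRingHom) ≫ g₁) ⁻¹ᵁ V = ⊤)
    (hg₂' : (Spec.map (CommRingCat.ofHom u.toRingHom) ≫ g₂) ⁻¹ᵁ V = ⊤) {δ : Γ(X, V) → B}
    (hδ : ∀ a, (g₂.appLE V ⊤ hg₂.ge ≫ (Scheme.ΓSpecIso (.of B)).hom).hom a =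
      (g₁.appLE V ⊤ hg₁.ge ≫ (Scheme.ΓSpecIso (.of B)).hom).hom a + δ a)
    {δ' : Γ(X, V) → C}
    (hδ' : ∀ a, ((Spec.map (CommRingCat.ofHom u.toRingHom) ≫ g₂).appLE V ⊤ hg₂'.ge ≫
        (Scheme.ΓSpecIso (.of C)).hom).hom a =
      ((Spec.map (CommRingCat.ofHom u.toRingHom) ≫ g₁).appLE V ⊤ hg₁'.ge ≫ (Scheme.ΓSpecIso (.of C)).hom).hom a +
        δ' a) (a : Γ(X, V)) :
    δ' a = u (δ a) :=
  add_left_cancel ((hδ' a).symm.trans (charts_specMap_comp_of_derivation u hV hg₁ hg₂ hg₁' hg₂' hδ a))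

end Source

/-! ### §2 Change of target: an `S`-morphism `h : X → X′` carrying `V` into an affine open `V′` -/

section Target

variable {X X' : Scheme.{u}} {V : X.Opens} {V' : X'.Opens} {R₀ B B₀ : Type u} [CommRing R₀] [CommRing B]
  [CommRing B₀] [Algebra R₀ B] (p : X ⟶ Spec (.of R₀)) (p' : X' ⟶ Spec (.of R₀)) (π : B →+* B₀)
  (h : X ⟶ X')

/-- Pushing an `S`-morphism `g : Spec B → X` along an `S`-morphism `h : X → X′` gives an `S`-morphism.
[cite: SGA1, Exp. III §5 Prop. 5.1] -/
theorem comp_over (hp : h ≫ p' = p) (g : Spec (.of B) ⟶ X)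
    (w : g ≫ p = Spec.map (CommRingCat.ofHom (algebraMap R₀ B))) :
    (g ≫ h) ≫ p' = Spec.map (CommRingCat.ofHom (algebraMap R₀ B)) := by
  rw [Category.assoc, hp, w]

/-- Two morphisms agreeing on `Spec B₀` still agree after `h`. [cite: SGA1, Exp. III §5 Prop. 5.1] -/
theorem comp_agree {g₁ g₂ : Spec (.of B) ⟶ X}
    (h₀ : Spec.map (CommRingCat.ofHom π) ≫ g₁ = Spec.map (CommRingCat.ofHom π) ≫ g₂) :
    Spec.map (CommRingCat.ofHom π) ≫ (g₁ ≫ h) = Spec.map (CommRingCat.ofHom π) ≫ (g₂ ≫ h) := by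
  rw [← Category.assoc, h₀, Category.assoc]

/-- The pushed morphism lands in `V′` when `h` carries `V` into `V′`. [cite: SGA1, Exp. III §5 Prop. 5.1] -/
theorem preimage_comp_eq_top (hVV' : V ≤ h ⁻¹ᵁ V') {g : Spec (.of B) ⟶ X} (hg : g ⁻¹ᵁ V = ⊤) :
    (g ≫ h) ⁻¹ᵁ V' = ⊤ :=
  top_le_iff.mp (hg.ge.trans fun _ hx => hVV' hx)

/-- **The chart of the pushed morphism is `ψ_g ∘ h^*`**: `(g ≫ h).appLE V′ ⊤ ≫ ΓSpecIso B = h.appLE V′ V ≫ (g.appLE V ⊤ ≫ ΓSpecIso B)`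
(Mathlib `Scheme.Hom.appLE_comp_appLE`; no affineness needed). [cite: SGA1, Exp. III §5 Prop. 5.1] -/
theorem chart_comp (hVV' : V ≤ h ⁻¹ᵁ V') (g : Spec (.of B) ⟶ X) (hg : g ⁻¹ᵁ V = ⊤) (hg' : (g ≫ h) ⁻¹ᵁ V' = ⊤) :
    (g ≫ h).appLE V' ⊤ hg'.ge ≫ (Scheme.ΓSpecIso (.of B)).hom =
      h.appLE V' V hVV' ≫ (g.appLE V ⊤ hg.ge ≫ (Scheme.ΓSpecIso (.of B)).hom) := by
  rw [← Category.assoc, Scheme.Hom.appLE_comp_appLE]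

/-- **Change of target on the torsor: the derivation of the pushed pair is `δ ∘ h^*`** ([SGA1, Exp. III Prop. 5.1],
functoriality in `X`: `dh : h^*Ω¹_{X′/S} → Ω¹_{X/S}` acting on `𝓗om(g₀^*Ω¹, 𝒥)`).  Stated on the charts: if
`ψ_{g₂} = ψ_{g₁} + δ` then `ψ_{g₂ ≫ h} = ψ_{g₁ ≫ h} + δ ∘ h^*`, `h^* = h.appLE V′ V`. [cite: SGA1, Exp. III §5 Prop. 5.1] -/
theorem charts_comp_of_derivation (hVV' : V ≤ h ⁻¹ᵁ V') {g₁ g₂ : Spec (.of B) ⟶ X} (hg₁ : g₁ ⁻¹ᵁ V = ⊤)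
    (hg₂ : g₂ ⁻¹ᵁ V = ⊤)
    (hg₁' : (g₁ ≫ h) ⁻¹ᵁ V' = ⊤) (hg₂' : (g₂ ≫ h) ⁻¹ᵁ V' = ⊤) {δ : Γ(X, V) → B}
    (hδ : ∀ a, (g₂.appLE V ⊤ hg₂.ge ≫ (Scheme.ΓSpecIso (.of B)).hom).hom a =
      (g₁.appLE V ⊤ hg₁.ge ≫ (Scheme.ΓSpecIso (.of B)).hom).hom a + δ a) (a' : Γ(X', V')) :
    ((g₂ ≫ h).appLE V' ⊤ hg₂'.ge ≫ (Scheme.ΓSpecIso (.of B)).hom).hom a' =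
      ((g₁ ≫ h).appLE V' ⊤ hg₁'.ge ≫ (Scheme.ΓSpecIso (.of B)).hom).hom a' + δ ((h.appLE V' V hVV').hom a') := by
  rw [chart_comp h hVV' g₂ hg₂ hg₂', chart_comp h hVV' g₁ hg₁ hg₁']
  exact hδ _

/-- The same read backwards: any `δ′` describing the pushed pair equals `δ ∘ h^*` pointwise (so the unique derivation of
★ `existsUnique_derivation_of_lifts` for `(g₁ ≫ h, g₂ ≫ h)` is `δ ∘ h^*`). [cite: SGA1, Exp. III §5 Prop. 5.1] -/
theorem derivation_comp_eq (hVV' : V ≤ h ⁻¹ᵁ V') {g₁ g₂ : Spec (.of B) ⟶ X} (hg₁ : g₁ ⁻¹ᵁ V = ⊤)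
    (hg₂ : g₂ ⁻¹ᵁ V = ⊤)
    (hg₁' : (g₁ ≫ h) ⁻¹ᵁ V' = ⊤) (hg₂' : (g₂ ≫ h) ⁻¹ᵁ V' = ⊤) {δ : Γ(X, V) → B}
    (hδ : ∀ a, (g₂.appLE V ⊤ hg₂.ge ≫ (Scheme.ΓSpecIso (.of B)).hom).hom a =
      (g₁.appLE V ⊤ hg₁.ge ≫ (Scheme.ΓSpecIso (.of B)).hom).hom a + δ a)
    {δ' : Γ(X', V') → B}
    (hδ' : ∀ a', ((g₂ ≫ h).appLE V' ⊤ hg₂'.ge ≫ (Scheme.ΓSpecIso (.of B)).hom).hom a' =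
      ((g₁ ≫ h).appLE V' ⊤ hg₁'.ge ≫ (Scheme.ΓSpecIso (.of B)).hom).hom a' + δ' a') (a' : Γ(X', V')) :
    δ' a' = δ ((h.appLE V' V hVV').hom a') :=
  add_left_cancel ((hδ' a').symm.trans (charts_comp_of_derivation h hVV' hg₁ hg₂ hg₁' hg₂' hδ a'))

/-- The scalar maps are compatible: `s_V = s_{V′} ≫ h^*` when `h` is an `S`-morphism — so `δ ∘ h^*` is again an
`R₀`-derivation for the scalar structure `s_{V′}` and the module structure through `ψ_{g₁ ≫ h} = ψ_{g₁} ∘ h^*`.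
[cite: SGA1, Exp. III §5 Prop. 5.1] -/
theorem scalar_comp_appLE (hp : h ≫ p' = p) (hVV' : V ≤ h ⁻¹ᵁ V') :
    ((Scheme.ΓSpecIso (.of R₀)).inv ≫ p'.appLE ⊤ V' le_top) ≫ h.appLE V' V hVV' =
      (Scheme.ΓSpecIso (.of R₀)).inv ≫ p.appLE ⊤ V le_top := by
  subst hp
  rw [Category.assoc, Scheme.Hom.appLE_comp_appLE]

end Target

end Literature.AlgebraicGeometry.Deformation

end
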